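import Literature.Analysis.SpecialFunctions.GegenbauerBivariate
import HarnessLib

/-!
# The Gegenbauer generating function on the region `p² ≤ q < 1`

`Σ_j P^λ_j(2p, q) = (1 - 2p + q)^{-λ}` for `λ ≥ 0` and real `p, q` with `p² ≤ q < 1`
(`hasSum_gegenbauerHom`), i.e. Andrews–Askey–Roy (6.4.10)
`(1 - 2tρ + ρ²)^{-λ} = Σ_j C^λ_j(t) ρ^j` for `|t| ≤ 1`, `0 ≤ ρ < 1`, in the bivariate form of
`GegenbauerBivariate` (`p = tρ`, `q = ρ²`). The point is the full range: the naive double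
binomial expansion of `(1 - (2p - q))^{-λ}` converges absolutely only for `2|p| + q < 1`; on the
whole region one factors `1 - 2p + q = |1 - ζ|²`, `ζ = p + i√(q - p²)` (`|ζ|² = q < 1`), takes
the Cauchy product of the two absolutely convergent complex binomial series
`(1 - ζ)^{-λ} = Σ a_k ζ^k` and its conjugate (Mathlib:
`Complex.one_div_one_sub_cpow_hasFPowerSeriesOnBall_zero`), groups by total degree, and
converts the Fourier form into the monomial form with `gegenbauerFourier_eq_hom`
(`ζ + \bar ζ = 2p`, `ζ \bar ζ = q`).

## References

* G. E. Andrews, R. Askey, R. Roy, *Special Functions*, CUP 1999, §6.4, (6.4.10)–(6.4.11).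
  [AndrewsAskeyRoy1999]
-/

noncomputable section

open Finset
open scoped Nat

namespace Literature.Analysis.SpecialFunctions

/-- `a_k(λ) = multichoose λ k` (Mathlib's binomial-ring coefficient). [folklore] -/
theorem gegenbauerA_eq_multichoose (lam : ℝ) (k : ℕ) :
    gegenbauerA lam k = Ring.multichoose lam k := by
  have h := Ring.factorial_nsmul_multichoose_eq_ascPochhammer lam k
  rw [nsmul_eq_mul, Polynomial.ascPochhammer_smeval_eq_eval] at h
  rw [gegenbauerA, ← h]
  have hk : (k ! : ℝ) ≠ 0 := by exact_mod_cast Nat.factorial_ne_zero k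
  field_simp

/-- `a_k(λ) ≥ 0` for `λ ≥ 0`. [folklore] -/
theorem gegenbauerA_nonneg {lam : ℝ} (hlam : 0 ≤ lam) (k : ℕ) : 0 ≤ gegenbauerA lam k := by
  unfold gegenbauerA
  refine div_nonneg ?_ (by positivity)
  rcases hlam.lt_or_eq with h | h
  · exact (ascPochhammer_pos k lam h).le
  · rw [← h, ascPochhammer_eval_zero]; split_ifs <;> norm_num

/-- The real binomial series `(1 - u)^{-λ} = Σ_k a_k(λ) u^k`, `|u| < 1` (Mathlib's
`Real.one_div_one_sub_rpow_hasFPowerSeriesOnBall_zero`). [folklore] -/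
theorem hasSum_gegenbauerA_mul_pow {lam u : ℝ} (hu : |u| < 1) :
    HasSum (fun k : ℕ => gegenbauerA lam k * u ^ k) ((1 - u) ^ (-lam)) := by
  have hp := Real.one_div_one_sub_rpow_hasFPowerSeriesOnBall_zero lam
  have hmem : u ∈ Metric.eball (0 : ℝ) 1 := by
    simp [Metric.mem_eball, enorm_eq_nnnorm, ← NNReal.coe_lt_one, coe_nnnorm, Real.norm_eq_abs,
      hu]
  have h := hp.hasSum hmem
  simp only [FormalMultilinearSeries.ofScalars_apply_eq, smul_eq_mul, zero_add] at h
  have h1 : 0 ≤ 1 - u := by linarith [(abs_lt.1 hu).2]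
  rw [one_div, ← Real.rpow_neg h1] at h
  have hf : (fun k : ℕ => gegenbauerA lam k * u ^ k) =
      fun n : ℕ => Ring.choose (lam + n - 1) n * u ^ n := by
    funext n; rw [gegenbauerA_eq_multichoose, Ring.multichoose_eq]
  rw [hf]
  exact h

/-- The complex binomial series `(1 - w)^{-λ} = Σ_k a_k(λ) w^k`, `‖w‖ < 1` (Mathlib's
`Complex.one_div_one_sub_cpow_hasFPowerSeriesOnBall_zero`). [folklore] -/
theorem hasSum_gegenbauerA_mul_cpow (lam : ℝ) {w : ℂ} (hw : ‖w‖ < 1) :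
    HasSum (fun k : ℕ => (gegenbauerA lam k : ℂ) * w ^ k) (1 / (1 - w) ^ (lam : ℂ)) := by
  have hp := Complex.one_div_one_sub_cpow_hasFPowerSeriesOnBall_zero (lam : ℂ)
  have hmem : w ∈ Metric.eball (0 : ℂ) 1 := by
    simp [Metric.mem_eball, enorm_eq_nnnorm, ← NNReal.coe_lt_one, coe_nnnorm, hw]
  have h := hp.hasSum hmem
  simp only [FormalMultilinearSeries.ofScalars_apply_eq, smul_eq_mul, zero_add] at h
  have hf : (fun k : ℕ => (gegenbauerA lam k : ℂ) * w ^ k) =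
      fun n : ℕ => Ring.choose ((lam : ℂ) + n - 1) n * w ^ n := by
    funext n
    rw [gegenbauerA_eq_multichoose, Ring.multichoose_eq, Complex.ofReal_choose]
    push_cast
    rfl
  rw [hf]
  exact h

/-- Absolute convergence of the complex binomial series in the unit disc. [folklore] -/
theorem summable_norm_gegenbauerA_mul_pow {lam : ℝ} (hlam : 0 ≤ lam) {w : ℂ} (hw : ‖w‖ < 1) :
    Summable (fun k : ℕ => ‖(gegenbauerA lam k : ℂ) * w ^ k‖) := by
  have h := (hasSum_gegenbauerA_mul_pow (lam := lam) (u := ‖w‖) (by rwa [abs_norm])).summable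
  refine h.congr fun k => ?_
  rw [norm_mul, norm_pow, Complex.norm_real, Real.norm_eq_abs,
    abs_of_nonneg (gegenbauerA_nonneg hlam k)]

open ComplexConjugate in
/-- The Cauchy product of the binomial series at `ζ` and its conjugate, grouped by total degree:
`Σ_j F^λ_j(ζ, \bar ζ) = |1 - ζ|^{-2λ} = (|1 - ζ|²)^{-λ}` (`‖ζ‖ < 1`, `λ ≥ 0`).
[cite: AndrewsAskeyRoy1999, §6.4 (factorisation before (6.4.11))] -/
theorem hasSum_gegenbauerFourier_conj {lam : ℝ} (hlam : 0 ≤ lam) {ζ : ℂ} (hζ : ‖ζ‖ < 1) :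
    HasSum (fun j : ℕ => gegenbauerFourier lam j ζ (conj ζ))
      (((‖1 - ζ‖ ^ 2) ^ (-lam) : ℝ) : ℂ) := by
  have h1 := hasSum_gegenbauerA_mul_cpow lam hζ
  have h2 : HasSum (fun k : ℕ => (gegenbauerA lam k : ℂ) * conj ζ ^ k)
      (conj (1 / (1 - ζ) ^ (lam : ℂ))) := by
    have := (Complex.hasSum_conj' ).2 h1
    simpa [map_mul, map_pow, Complex.conj_ofReal] using this
  have hs1 := summable_norm_gegenbauerA_mul_pow hlam hζ
  have hs2 : Summable (fun k : ℕ => ‖(gegenbauerA lam k : ℂ) * conj ζ ^ k‖) := by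
    simpa [norm_mul, norm_pow, Complex.norm_conj] using hs1
  have hsum := (summable_sum_mul_antidiagonal_of_summable_norm' hs1 h1.summable hs2
    h2.summable :)
  have heq := (tsum_mul_tsum_eq_tsum_sum_antidiagonal_of_summable_norm hs1 hs2 :)
  have hval := hsum.hasSum
  rw [← heq, h1.tsum_eq, h2.tsum_eq] at hval
  -- the value
  have hpos : 0 < ‖1 - ζ‖ := by
    have : ζ ≠ 1 := fun h => by simp [h] at hζ
    exact norm_pos_iff.2 (sub_ne_zero.2 (Ne.symm this))
  have hGG : 1 / (1 - ζ) ^ (lam : ℂ) * conj (1 / (1 - ζ) ^ (lam : ℂ)) =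
      (((‖1 - ζ‖ ^ 2) ^ (-lam) : ℝ) : ℂ) := by
    rw [Complex.mul_conj, Complex.normSq_eq_norm_sq]
    congr 1
    rw [norm_div, norm_one, Complex.norm_cpow_real, div_pow, one_pow,
      ← Real.rpow_natCast (‖1 - ζ‖ ^ lam) 2, ← Real.rpow_mul hpos.le,
      ← Real.rpow_natCast ‖1 - ζ‖ 2, ← Real.rpow_mul hpos.le, one_div, ← Real.rpow_neg hpos.le]
    congr 1
    push_cast
    ring
  rw [hGG] at hval
  have hfun : (fun n : ℕ => ∑ kl ∈ antidiagonal n, (gegenbauerA lam kl.1 : ℂ) * ζ ^ kl.1 *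
      ((gegenbauerA lam kl.2 : ℂ) * conj ζ ^ kl.2)) =
      fun j : ℕ => gegenbauerFourier lam j ζ (conj ζ) := by
    funext j
    simp only [gegenbauerFourier, Complex.real_smul, Complex.ofReal_mul]
    refine Finset.sum_congr rfl fun x _ => ?_
    ring
  rw [hfun] at hval
  exact hval

/-- **The Gegenbauer generating function in the bivariate form, on the closed region
`p² ≤ q < 1`**: `Σ_j P^λ_j(2p, q) = (1 - 2p + q)^{-λ}` for `λ ≥ 0`. (With `p = ρ t`, `q = ρ²`
this is `Σ_j C^λ_j(t) ρ^j = (1 - 2ρt + ρ²)^{-λ}`, `|t| ≤ 1`, `0 ≤ ρ < 1`.) Proof: `ζ = p +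
i√(q - p²)` has `ζ + \bar ζ = 2p`, `ζ \bar ζ = q`, `|1 - ζ|² = 1 - 2p + q`, and the double
binomial series `(1-ζ)^{-λ}(1-\bar ζ)^{-λ}` regroups by total degree.
[cite: AndrewsAskeyRoy1999, (6.4.10)] -/
theorem hasSum_gegenbauerHom {lam : ℝ} (hlam : 0 ≤ lam) {p q : ℝ} (hpq : p ^ 2 ≤ q)
    (hq : q < 1) :
    HasSum (fun j : ℕ => gegenbauerHom lam j (2 * p) q) ((1 - 2 * p + q) ^ (-lam)) := by
  set ζ : ℂ := ⟨p, Real.sqrt (q - p ^ 2)⟩ with hζ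
  have hsq : Real.sqrt (q - p ^ 2) ^ 2 = q - p ^ 2 := Real.sq_sqrt (by linarith)
  have hnorm : ‖ζ‖ < 1 := by
    have : ‖ζ‖ ^ 2 < 1 := by
      rw [← Complex.normSq_eq_norm_sq, Complex.normSq_apply]
      simp only [hζ]
      nlinarith
    exact (pow_lt_one_iff_of_nonneg (norm_nonneg _) two_ne_zero).1 this
  have hsum : ζ + (starRingEnd ℂ) ζ = ((2 * p : ℝ) : ℂ) := by
    apply Complex.ext
    · simp [hζ]; ring
    · simp [hζ]
  have hprod : ζ * (starRingEnd ℂ) ζ = ((q : ℝ) : ℂ) := by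
    rw [Complex.mul_conj, Complex.normSq_apply]
    simp only [hζ]
    push_cast
    rw [show (p : ℂ) * p + (Real.sqrt (q - p ^ 2) : ℂ) * (Real.sqrt (q - p ^ 2)) =
      ((p * p + Real.sqrt (q - p ^ 2) ^ 2 : ℝ) : ℂ) by push_cast; ring, hsq]
    push_cast
    ring
  have hbase : ‖1 - ζ‖ ^ 2 = 1 - 2 * p + q := by
    rw [← Complex.normSq_eq_norm_sq, Complex.normSq_apply]
    simp only [hζ, Complex.sub_re, Complex.one_re, Complex.sub_im, Complex.one_im]
    nlinarith
  have h := hasSum_gegenbauerFourier_conj hlam hnorm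
  rw [hbase] at h
  have h' : HasSum (fun j : ℕ => ((gegenbauerHom lam j (2 * p) q : ℝ) : ℂ))
      (((1 - 2 * p + q) ^ (-lam) : ℝ) : ℂ) := by
    convert h using 2 with j
    rw [gegenbauerFourier_eq_hom, hsum, hprod]
    exact (gegenbauerHom_algebraMap (A := ℂ) lam j (2 * p) q).symm
  exact_mod_cast (Complex.hasSum_iff _ _ |>.1 h').1

end Literature.Analysis.SpecialFunctions

end
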